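import Literature.NumberTheory.PAdicHodge.UnramifiedCompletionEmbedding
import Literature.NumberTheory.PAdicHodge.AxSenTate
import Mathlib.RingTheory.Perfectoid.BDeRham
import HarnessLib

/-!
# `𝒪_{ℂ_F}` is an integral perfectoid input for Fontaine's `θ`: `𝔸_inf(F)`, `B_dR⁺(F)`, `B_dR(F)` as rings

Let `F` be a non-archimedean local field of characteristic `0` and residue characteristic `p`
(`hp : valuation F p < 1`), `ℂ_F = CompletedAlgClosure F`, `𝒪_{ℂ_F} = integerC F` its closed unit
ball (`UnramifiedCompletionEmbedding`). Mathlib (`RingTheory/Perfectoid/*`, Jiang 2025) constructs,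
for a commutative ring `R` with `p` not a unit and `R` `p`-adically complete and separated,
the tilt `R♭`, Fontaine's `θ : 𝕎(R♭) → R` (`WittVector.fontaineTheta`, surjective as soon as
Frobenius is surjective on `R/p`, `surjective_fontaineTheta`), and the rings
`B_dR⁺(R) = (𝕎(R♭)[1/p])^∧_{ker θ}`, `B_dR(R)` (`BDeRhamPlus`, `BDeRham`; bare rings — no Galois
action, filtration or DVR structure yet, listed there as TODO).

This file verifies Mathlib's hypotheses for `R = 𝒪_{ℂ_F}`:
* `not_isUnit_natCast_integerC` : `p` is not a unit of `𝒪_{ℂ_F}` (`‖p‖ < 1`);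
* `isAdicComplete_integerC_natCast` : `𝒪_{ℂ_F}` is `p`-adically complete and separated
  (`isAdicComplete_integerC`);
* `frobenius_modP_integerC_surjective` : **Frobenius is surjective on `𝒪_{ℂ_F}/p`** — approximate
  `x ∈ 𝒪_{ℂ_F}` by `y ∈ 𝒪_{F̄}` within `‖p‖` (density of `F̄`) and extract a `p`-th root of `y`
  in the algebraically closed field `F̄`;
hence **Fontaine's `θ : 𝔸_inf(F) = 𝕎(𝒪_{ℂ_F}♭) → 𝒪_{ℂ_F}` is surjective**
(`surjective_fontaineTheta_integerC`), and records `Ainf F hp`, `BdRPlus F hp`, `BdR F hp` —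
Fontaine's rings for `F` AS RINGS, namely Mathlib's constructions at `R = 𝒪_{ℂ_F}` (Fontaine 1994,
Exp. II §1.2–1.5). The `Γ_F`-action (functoriality of `𝕎`, tilt and completion), `ker θ = (ξ)`,
the DVR structure and `Fil^i = (ker θ)^i` are the remaining components of `B_dR(F)` as a
`PeriodRingData` (component A4 of the T0 inventory of `FontaineDatumExists`).

## References

* J.-M. Fontaine, *Le corps des périodes p-adiques*, Astérisque 223 (1994), Exp. II §1.2–§1.5. [FontaineAsterisque223III]
* J.-M. Fontaine, Y. Ouyang, *Theory of p-adic Galois representations*, §4.1–4.2 (`R = 𝒪_C^♭`, `θ`, `B_dR`). [FontaineOuyang2022]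
-/

noncomputable section

open ValuativeRel Field UniformSpace Ideal WittVector

namespace Literature.NumberTheory.PAdicHodge

open Literature.NumberTheory.GaloisRepresentations
open Literature.NumberTheory.GaloisRepresentations.IsNonarchimedeanLocalField

variable {F : Type} [Field F] [ValuativeRel F] [TopologicalSpace F] [IsNonarchimedeanLocalField F]
  [CharZero F] {p : ℕ} [Fact p.Prime]

/-! ### `p ∈ 𝒪_{ℂ_F}`: `0 < ‖p‖ < 1` -/

omit [CharZero F] [Fact p.Prime] in
/-- `‖p‖_{ℂ_F} < 1` (`p` is the residue characteristic of `F`). [folklore] -/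
theorem norm_natCast_C_lt_one (hp : valuation F p < 1) : ‖(p : CompletedAlgClosure F)‖ < 1 := by
  rw [← map_natCast (algebraMap F (CompletedAlgClosure F)), CompletedAlgClosure.norm_algebraMap]
  exact (norm_lt_one_iff F _).mpr hp

omit [Fact p.Prime] in
/-- `p ≠ 0` in `ℂ_F` (characteristic `0`). [folklore] -/
theorem natCast_C_ne_zero (hp0 : p ≠ 0) : (p : CompletedAlgClosure F) ≠ 0 := by
  rw [← map_natCast (algebraMap F (CompletedAlgClosure F)), map_ne_zero]
  exact_mod_cast hp0

omit [CharZero F] [Fact p.Prime] in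
/-- The coercion of `p ∈ 𝒪_{ℂ_F}` to `ℂ_F`. [folklore] -/
theorem coe_natCast_integerC : ((p : integerC F) : CompletedAlgClosure F) = (p : CompletedAlgClosure F) :=
  Subring.coe_natCast _ _

omit [CharZero F] [Fact p.Prime] in
/-- **`p` is not a unit of `𝒪_{ℂ_F}`.** [folklore] -/
theorem not_isUnit_natCast_integerC (hp : valuation F p < 1) : ¬ IsUnit (p : integerC F) := by
  rintro ⟨u, hu⟩
  set a : CompletedAlgClosure F := ((u : integerC F) : CompletedAlgClosure F) with ha
  set b : CompletedAlgClosure F := (((u⁻¹ : (integerC F)ˣ) : integerC F) : CompletedAlgClosure F) with hb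
  have h1 : ‖a‖ * ‖b‖ = 1 := by
    rw [← norm_mul, ha, hb, ← Subring.coe_mul, Units.mul_inv, Subring.coe_one, norm_one]
  have h2 : ‖a‖ < 1 := by
    rw [ha, hu, coe_natCast_integerC]; exact norm_natCast_C_lt_one hp
  have h3 : ‖b‖ ≤ 1 := norm_coe_integerC_le _
  have : ‖a‖ * ‖b‖ < 1 := mul_lt_one_of_nonneg_of_lt_one_left (norm_nonneg _) h2 h3
  exact this.ne h1

/-- **`𝒪_{ℂ_F}` is `p`-adically complete and separated.** [cite: FontaineOuyang2022, §4.1] -/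
theorem isAdicComplete_integerC_natCast (hp : valuation F p < 1) : IsAdicComplete (Ideal.span {(p : integerC F)}) (integerC F) :=
  isAdicComplete_integerC (by rw [coe_natCast_integerC]; exact natCast_C_ne_zero (Fact.out : p.Prime).ne_zero)
    (by rw [coe_natCast_integerC]; exact norm_natCast_C_lt_one hp)

/-! ### Frobenius is surjective on `𝒪_{ℂ_F}/p` -/

/-- Every element of `𝒪_{ℂ_F}` is a `p`-th power modulo `p`: approximate by an element of `𝒪_{F̄}`
within `‖p‖` and take a `p`-th root in the algebraically closed field `F̄`.
[cite: FontaineOuyang2022, §4.1] -/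
theorem exists_pow_sub_mem_span (hp : valuation F p < 1) (x : integerC F) :
    ∃ z : integerC F, z ^ p - x ∈ Ideal.span {(p : integerC F)} := by
  have hpP : p.Prime := Fact.out
  have hp0 : (p : CompletedAlgClosure F) ≠ 0 := natCast_C_ne_zero hpP.ne_zero
  have hpos : 0 < ‖(p : CompletedAlgClosure F)‖ := norm_pos_iff.mpr hp0
  -- approximate `x` by `y₀ ∈ F̄`
  obtain ⟨y₀, hy₀⟩ := (CompletedAlgClosure.denseRange_coe (F := F)).exists_dist_lt (x : CompletedAlgClosure F) hpos
  rw [dist_eq_norm] at hy₀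
  -- `p`-th root in `F̄`
  obtain ⟨z₀, hz₀⟩ := IsAlgClosed.exists_pow_nat_eq y₀ hpP.pos
  have hy₀norm : ‖(y₀ : CompletedAlgClosure F)‖ ≤ 1 := by
    have h : (y₀ : CompletedAlgClosure F) = (x : CompletedAlgClosure F) - ((x : CompletedAlgClosure F) - y₀) := by ring
    rw [h]
    refine (norm_sub_le_max' _ _).trans (max_le x.2 ?_)
    exact hy₀.le.trans (norm_natCast_C_lt_one hp).le
  have hcoe : ((z₀ ^ p : NormedAlgClosure F) : CompletedAlgClosure F) = (z₀ : CompletedAlgClosure F) ^ p :=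
    map_pow (Completion.coeRingHom (α := NormedAlgClosure F)) z₀ p
  have hz₀norm : ‖(z₀ : CompletedAlgClosure F)‖ ≤ 1 := by
    have h : ‖(z₀ : CompletedAlgClosure F)‖ ^ p ≤ 1 := by
      rw [← norm_pow, ← hcoe, hz₀]; exact hy₀norm
    exact (pow_le_one_iff_of_nonneg (norm_nonneg _) hpP.ne_zero).mp h
  refine ⟨⟨(z₀ : CompletedAlgClosure F), hz₀norm⟩, ?_⟩
  rw [← pow_one (Ideal.span {(p : integerC F)}), mem_span_pow_iff
    (by rw [coe_natCast_integerC]; exact hp0) 1, pow_one, coe_natCast_integerC]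
  change ‖(z₀ : CompletedAlgClosure F) ^ p - (x : CompletedAlgClosure F)‖ ≤ ‖(p : CompletedAlgClosure F)‖
  rw [← hcoe, hz₀, norm_sub_rev]
  exact hy₀.le

/-- **Frobenius is surjective on `𝒪_{ℂ_F}/p`** (`𝒪_{ℂ_F}` is integral perfectoid).
[cite: FontaineOuyang2022, §4.1] -/
theorem frobenius_modP_integerC_surjective (hp : valuation F p < 1) :
    haveI : Fact (¬ IsUnit (p : integerC F)) := ⟨not_isUnit_natCast_integerC hp⟩
    Function.Surjective (frobenius (ModP (integerC F) p) p) := by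
  haveI : Fact (¬ IsUnit (p : integerC F)) := ⟨not_isUnit_natCast_integerC hp⟩
  intro y
  obtain ⟨x, rfl⟩ := Ideal.Quotient.mk_surjective y
  obtain ⟨z, hz⟩ := exists_pow_sub_mem_span hp x
  refine ⟨Ideal.Quotient.mk _ z, ?_⟩
  rw [frobenius_def, ← map_pow, Ideal.Quotient.eq]
  exact hz

/-! ### Fontaine's `θ` for `F` and the rings `𝔸_inf(F)`, `B_dR⁺(F)`, `B_dR(F)` -/

/-- **Fontaine's `θ : 𝕎(𝒪_{ℂ_F}♭) → 𝒪_{ℂ_F}` is surjective** (Mathlib `surjective_fontaineTheta` at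
`R = 𝒪_{ℂ_F}`, whose hypotheses are the three theorems above). [cite: FontaineAsterisque223III, Exp. II §1.2]
[cite: FontaineOuyang2022, §4.2] -/
theorem surjective_fontaineTheta_integerC (hp : valuation F p < 1) :
    haveI : Fact (¬ IsUnit (p : integerC F)) := ⟨not_isUnit_natCast_integerC hp⟩
    haveI := isAdicComplete_integerC_natCast hp
    Function.Surjective (fontaineTheta (integerC F) p) := by
  haveI : Fact (¬ IsUnit (p : integerC F)) := ⟨not_isUnit_natCast_integerC hp⟩
  haveI := isAdicComplete_integerC_natCast hp
  exact surjective_fontaineTheta (frobenius_modP_integerC_surjective hp)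

variable (F) in
/-- **`𝔸_inf(F) = 𝕎(𝒪_{ℂ_F}♭)`**, Fontaine's ring for the local field `F` (Mathlib's Witt vectors of
the tilt `PreTilt`). [cite: FontaineAsterisque223III, Exp. II §1.2] -/
abbrev Ainf : Type := WittVector p (PreTilt (integerC F) p)

variable (F) in
/-- **`B_dR⁺(F)`** as a ring: Mathlib's `BDeRhamPlus (𝒪_{ℂ_F}) p`, the `ker θ`-adic completion of
`𝔸_inf(F)[1/p]` (Fontaine 1994, Exp. II §1.5). The `Γ_F`-action, the DVR structure and the
filtration are NOT constructed here. [cite: FontaineAsterisque223III, Exp. II §1.5] -/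
def BdRPlus (_hp : valuation F p < 1) : Type :=
  haveI : Fact (¬ IsUnit (p : integerC F)) := ⟨not_isUnit_natCast_integerC _hp⟩
  haveI := isAdicComplete_integerC_natCast _hp
  BDeRhamPlus (integerC F) p

/-- `B_dR⁺(F)` is a commutative ring. [folklore] -/
instance instCommRingBdRPlus (hp : valuation F p < 1) : CommRing (BdRPlus F hp) := by
  unfold BdRPlus; infer_instance

variable (F) in
/-- **`B_dR(F)`** as a ring: Mathlib's `BDeRham (𝒪_{ℂ_F}) p` (`B_dR⁺` with the generators of
`ker θ` inverted; Fontaine 1994, Exp. II §1.5). [cite: FontaineAsterisque223III, Exp. II §1.5] -/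
def BdR (_hp : valuation F p < 1) : Type :=
  haveI : Fact (¬ IsUnit (p : integerC F)) := ⟨not_isUnit_natCast_integerC _hp⟩
  haveI := isAdicComplete_integerC_natCast _hp
  BDeRham (integerC F) p

/-- `B_dR(F)` is a commutative ring. [folklore] -/
instance instCommRingBdR (hp : valuation F p < 1) : CommRing (BdR F hp) := by
  unfold BdR BDeRham; infer_instance

end Literature.NumberTheory.PAdicHodge

end
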